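import Mathlib
import HarnessLib
import Summits.HubbardSuperconductivity.HubbardSuperconductivity.Theses.LiebTwin
import Summits.HubbardSuperconductivity.HubbardSuperconductivity.Theorems.EnslavedA1gLowerSandwich
import Literature.MathematicalPhysics.QuantumLattice.PairCorrelationsProofs

/-!
# Crux `NoOnsiteODLRO` (stmt-HubbardSuperconductivity-0933), birth skeleton — stub
# `stub_zeroTemperatureFalkBruch`: the zero-temperature Falk–Bruch step

For the repulsive Hubbard torus `H = hubbardTorus 2 L 1 U`, an admissible `(N_L, S^z = 0)`-sector
ground state `ψ_L` and the on-site pair field `P_s = pairField sWave L`, write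
`S_L := Re⟨P_s ψ_L, P_s ψ_L⟩ = Re⟨ψ_L, P_sᴴ P_s ψ_L⟩`. GIVEN the `U`-shifted infrared bound at side `L`
with constant `C`,
`|⟨v, P_s ψ_L⟩|² ≤ C · L² · (Re⟨v, H v⟩ + (U - E_{N_L}) ‖v‖²)` for all `v` in the pair-removed sector
`(N_L - 2, 0)`, we deduce `S_L³ ≤ K · L⁸` with `K = 4 C² c₀²`, `c₀ = Σ_{e ∈ {0} ∪ unitSteps} 2|s'(e)|/√2`
(`= 4√2`, so `K = 128 C²`), independent of `L`.

Proof (Falk–Bruch 1969 / Dyson–Lieb–Simon 1978, Thm 3.1, in its `T = 0` form à la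
Pitaevskii–Stringari 1991): test the bound on `v := P_s ψ_L` itself (it lies in the `(N_L - 2, 0)`
sector, `pairFieldAt_mulVec_mem_szSector`), so `S_L² ≤ C L² Re⟨P_s ψ, (H - E + U) P_s ψ⟩`; by the
landed enslaving identity `H P_s - P_s H + U P_s = 2 P_{s'}` (`enslavedA1gIdentity_proof`, `L > 2`,
Zhang 1990 / Yang 1989) and `H ψ = E ψ` the bracket equals `2 Re⟨P_s ψ, P_{s'} ψ⟩ ≤ 2 √S_L ‖P_{s'} ψ‖`
(Cauchy–Schwarz) and `‖P_{s'} ψ‖ ≤ c₀ L²` (each local pair is a sum of products of two contractions,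
`norm_toLp_localPair_mulVec_le`, summed over the `L²` sites). Hence `S_L^{3/2} ≤ 2 C c₀ L⁴`.
All ingredients are proved tree lemmas; the bookkeeping is folklore.
-/

noncomputable section

open Matrix Finset Filter
open scoped ComplexOrder
open Literature.Probability.LatticeModels Literature.MathematicalPhysics.QuantumLattice

namespace Summit.HubbardSuperconductivity.NoOnsiteODLRO.Birth

/-- **A-priori bound on the pair field.** For every form factor `g`, side `L` and Fock vector `ψ`,
`‖Δ_g ψ‖ ≤ c_g · L² · ‖ψ‖` with `c_g = Σ_{e ∈ {0} ∪ unitSteps} 2 |g e| / √2`: the pair field is the sum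
over the `L²` torus sites of the local pairs, each bounded by `c_g` (`norm_toLp_localPair_mulVec_le`,
annihilation operators are contractions). Scalapino, Phys. Rep. 250 (1995) 329, §2;
Bratteli–Robinson II §5.2.2. [folklore] -/
theorem norm_toLp_pairField_mulVec_le_mul_sq (g : Site 2 → ℝ) (L : ℕ) [NeZero L]
    (ψ : Fock (Orb (FermionTorus 2 L))) :
    ‖(WithLp.toLp 2 (pairField g L *ᵥ ψ) : EuclideanSpace ℂ (Finset (Orb (FermionTorus 2 L))))‖ ≤
      (∑ e ∈ insert 0 unitSteps, ‖((g e / Real.sqrt 2 : ℝ) : ℂ)‖ * 2) * (L : ℝ) ^ 2 *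
        ‖(WithLp.toLp 2 ψ : EuclideanSpace ℂ (Finset (Orb (FermionTorus 2 L))))‖ := by
  rw [pairField, Matrix.sum_mulVec, WithLp.toLp_sum]
  refine (norm_sum_le _ _).trans ?_
  calc ∑ x : TorusSite 2 L, ‖(WithLp.toLp 2 (localPair g L x *ᵥ ψ) :
          EuclideanSpace ℂ (Finset (Orb (FermionTorus 2 L))))‖
      ≤ ∑ _x : TorusSite 2 L, (∑ e ∈ insert 0 unitSteps, ‖((g e / Real.sqrt 2 : ℝ) : ℂ)‖ * 2) *
          ‖(WithLp.toLp 2 ψ : EuclideanSpace ℂ (Finset (Orb (FermionTorus 2 L))))‖ :=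
        Finset.sum_le_sum fun x _ => norm_toLp_localPair_mulVec_le g L x ψ
    _ = (∑ e ∈ insert 0 unitSteps, ‖((g e / Real.sqrt 2 : ℝ) : ℂ)‖ * 2) * (L : ℝ) ^ 2 *
          ‖(WithLp.toLp 2 ψ : EuclideanSpace ℂ (Finset (Orb (FermionTorus 2 L))))‖ := by
        have hcard : Fintype.card (TorusSite 2 L) = L ^ 2 := by simp [ZMod.card]
        rw [Finset.sum_const, Finset.card_univ, hcard, nsmul_eq_mul]
        push_cast
        ring

/-- **A-priori bound on the pair field, existential form**: for every form factor `g` there is a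
constant `c ≥ 0`, independent of the side `L`, with `‖Δ_g ψ‖ ≤ c · L² · ‖ψ‖` for every Fock vector `ψ`
on every torus (`norm_toLp_pairField_mulVec_le_mul_sq`). Scalapino, Phys. Rep. 250 (1995) 329, §2.
[folklore] -/
theorem exists_norm_toLp_pairField_mulVec_le (g : Site 2 → ℝ) :
    ∃ c : ℝ, 0 ≤ c ∧ ∀ (L : ℕ) [NeZero L] (ψ : Fock (Orb (FermionTorus 2 L))),
      ‖(WithLp.toLp 2 (pairField g L *ᵥ ψ) : EuclideanSpace ℂ (Finset (Orb (FermionTorus 2 L))))‖ ≤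
        c * (L : ℝ) ^ 2 * ‖(WithLp.toLp 2 ψ : EuclideanSpace ℂ (Finset (Orb (FermionTorus 2 L))))‖ :=
  ⟨_, localPairNormBound_nonneg g, fun L _ ψ => norm_toLp_pairField_mulVec_le_mul_sq g L ψ⟩

/-- The real-arithmetic core of the zero-temperature Falk–Bruch step: if `x ≥ 0` and
`x⁴ ≤ A · x`, then `(x²)³ ≤ A²` (for `x > 0` divide by `x` and square `x³ ≤ A`).
Pitaevskii–Stringari, J. Low Temp. Phys. 85 (1991) 377. [folklore] -/
theorem sq_pow_three_le_of_pow_four_le {x A : ℝ} (hx : 0 ≤ x) (h : x ^ 4 ≤ A * x) :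
    (x ^ 2) ^ 3 ≤ A ^ 2 := by
  rcases hx.eq_or_lt with h0 | hpos
  · rw [← h0]
    have hA2 : 0 ≤ A ^ 2 := sq_nonneg A
    simpa using hA2
  · have h4 : x ^ 3 * x ≤ A * x := by rw [← pow_succ]; exact h
    have h3 : x ^ 3 ≤ A := le_of_mul_le_mul_right h4 hpos
    calc (x ^ 2) ^ 3 = (x ^ 3) ^ 2 := by ring
      _ ≤ A ^ 2 := pow_le_pow_left₀ (pow_nonneg hx 3) h3 2

/-- **`stub_zeroTemperatureFalkBruch`** (crux `NoOnsiteODLRO`, birth skeleton, Stub 2 — the engine).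
For all `U > 0`, `δ ∈ (0,1/2)`, every admissible `(N, ψ)` and every `C ≥ 0` there are `K ≥ 0`
(namely `K = 4 C² c₀²`, `c₀ = Σ_{e ∈ {0} ∪ unitSteps} 2|s'(e)|/√2`) and `L₁` (namely `3`) such that for
every even `L ≥ L₁`: IF the `U`-shifted infrared bound
`|⟨v, P_s ψ_L⟩|² ≤ C L² (Re⟨v, H v⟩ + (U - E_{N_L}) ‖v‖²)` holds for all `v` in the sector
`(N_L - 2, 0)`, THEN `S_L³ ≤ K L⁸`, `S_L = Re⟨ψ_L, P_sᴴ P_s ψ_L⟩`. Proof: test the bound on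
`v := P_s ψ_L ∈ (N_L - 2, 0)`; by `enslavedA1gIdentity_proof` and `H ψ_L = E ψ_L` the bracket is
`2 Re⟨P_s ψ, P_{s'} ψ⟩ ≤ 2 √S_L · c₀ L²` (Cauchy–Schwarz and the a-priori bound), whence
`S_L² ≤ 2 C c₀ L⁴ √S_L`. Falk–Bruch, Phys. Rev. 180 (1969) 442; Dyson–Lieb–Simon, J. Stat. Phys. 18
(1978) 335, Thm 3.1; Pitaevskii–Stringari, J. Low Temp. Phys. 85 (1991) 377; Zhang, PRL 65 (1990) 120;
Yang, PRL 63 (1989) 2144. [folklore] -/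
theorem stub_zeroTemperatureFalkBruch :
    ∀ (U δ : ℝ), 0 < U → δ ∈ Set.Ioo (0 : ℝ) (1 / 2) →
      ∀ (N : ℕ → ℕ) (ψ : ∀ L, Fock (Orb (FermionTorus 2 L))),
        (∀ L, Even L → N L = 2 * ⌊(1 - δ) * (L : ℝ) ^ 2 / 2⌋₊ ∧ star (ψ L) ⬝ᵥ ψ L = 1 ∧
            IsGroundStateInSector (hubbardTorus 2 L 1 U) (N L) 0 (ψ L)) →
          ∀ C : ℝ, 0 ≤ C → ∃ K : ℝ, 0 ≤ K ∧ ∃ L₁ : ℕ, ∀ (L : ℕ) [NeZero L], Even L → L₁ ≤ L →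
            (∀ v : Fock (Orb (FermionTorus 2 L)), v ∈ szSector (Λ := FermionTorus 2 L) (N L - 2) 0 →
              ‖star v ⬝ᵥ ((pairField sWave L) *ᵥ (ψ L))‖ ^ 2 ≤
                C * (L : ℝ) ^ 2 *
                  ((expect (hubbardTorus 2 L 1 U) v).re +
                    (U - (hubbardTorus 2 L 1 U).minEnergyOn (szSector (Λ := FermionTorus 2 L) (N L) 0)) *
                      (star v ⬝ᵥ v).re)) →
            (expect ((pairField sWave L)ᴴ * pairField sWave L) (ψ L)).re ^ 3 ≤ K * (L : ℝ) ^ 8 := by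
  intro U δ _hU hδ N ψ hyp C hC
  -- the a-priori constant `c₀` of the extended-`s` pair field: `‖P_{s'} ψ‖ ≤ c₀ L² ‖ψ‖`
  obtain ⟨c₀, -, hapr⟩ := exists_norm_toLp_pairField_mulVec_le extendedSWave
  refine ⟨(2 * C * c₀) ^ 2, sq_nonneg _, 3, fun L _ hE hL hIR => ?_⟩
  obtain ⟨hN, hψ1, hmem, _hne, hHψ⟩ := hyp L hE
  -- `2 ≤ N L`
  have hN2 : 2 ≤ N L := by
    rw [hN]
    have hδ1 : 1 / 2 < 1 - δ := by linarith [hδ.2]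
    have hL3 : (3 : ℝ) ≤ L := by exact_mod_cast hL
    have hL9 : (9 : ℝ) ≤ (L : ℝ) ^ 2 := by nlinarith [hL3]
    have hhalf : 1 / 2 * (L : ℝ) ^ 2 ≤ (1 - δ) * (L : ℝ) ^ 2 :=
      mul_le_mul_of_nonneg_right hδ1.le (sq_nonneg _)
    have h1 : ((1 : ℕ) : ℝ) ≤ (1 - δ) * (L : ℝ) ^ 2 / 2 := by
      rw [Nat.cast_one, le_div_iff₀ (by norm_num : (0 : ℝ) < 2)]
      linarith
    have h1' : 1 ≤ ⌊(1 - δ) * (L : ℝ) ^ 2 / 2⌋₊ := Nat.le_floor h1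
    omega
  -- `‖ψ‖ = 1`
  have h1 : ‖(WithLp.toLp 2 (ψ L) : EuclideanSpace ℂ (Finset (Orb (FermionTorus 2 L))))‖ = 1 := by
    have h := norm_toLp_sq_eq_re (ψ L)
    rw [hψ1, Complex.one_re] at h
    exact (pow_eq_one_iff_of_nonneg (norm_nonneg _) two_ne_zero).1 h
  -- notation
  rw [PosSemidefTrace.expect_conjTranspose_mul]
  set H := hubbardTorus 2 L 1 U with hHdef
  set E : ℝ := H.minEnergyOn (szSector (Λ := FermionTorus 2 L) (N L) 0) with hEdef
  set φ' := pairField sWave L *ᵥ ψ L with hφ'def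
  set w := pairField extendedSWave L *ᵥ ψ L with hwdef
  -- (a) `P_s ψ ∈ szSector (N - 2) 0`
  have hφ'mem : φ' ∈ szSector (Λ := FermionTorus 2 L) (N L - 2) 0 := by
    have h := Summit.HubbardSuperconductivity.HubbardSuperconductivity.Theorems.WcbcsSsbToTorusLRO.pairFieldAt_mulVec_mem_szSector
      sWave (0 : TorusSite 2 L) hN2 hmem
    rwa [pairFieldAt_zero] at h
  -- (b) the enslaved-A1g identity applied to `ψ`: `2 P_{s'} ψ = (H - E + U) P_s ψ`
  have hid := Summit.HubbardSuperconductivity.EnslavedA1g.enslavedA1gIdentity_proof L (by omega) U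
  have h2v : (2 : ℂ) • w = H *ᵥ φ' - ((E : ℝ) : ℂ) • φ' + (U : ℂ) • φ' := by
    have h := congrArg (fun M => M *ᵥ ψ L) hid
    rw [smul_mulVec, add_mulVec, sub_mulVec, ← mulVec_mulVec, ← mulVec_mulVec, hHψ, mulVec_smul,
      smul_mulVec] at h
    exact h
  -- the bracket of the infrared bound at `v = P_s ψ` is `2 Re⟨P_s ψ, P_{s'} ψ⟩`
  have hbr : (expect H φ').re + (U - E) * (star φ' ⬝ᵥ φ').re = 2 * (star φ' ⬝ᵥ w).re := by
    rw [← Summit.HubbardSuperconductivity.EnslavedA1g.re_two_smul_dotProduct, h2v, dotProduct_add,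
      dotProduct_sub, dotProduct_smul, dotProduct_smul, Complex.add_re, Complex.sub_re, smul_eq_mul,
      smul_eq_mul, Complex.re_ofReal_mul, Complex.re_ofReal_mul]
    simp only [Literature.MathematicalPhysics.QuantumLattice.expect]
    ring
  -- (c) the infrared bound tested on `v = P_s ψ`
  have hIRφ := hIR φ' hφ'mem
  -- (d) norms and Cauchy–Schwarz
  obtain ⟨nu, hnu, hnudef⟩ : ∃ nu : ℝ, 0 ≤ nu ∧
      ‖(WithLp.toLp 2 φ' : EuclideanSpace ℂ (Finset (Orb (FermionTorus 2 L))))‖ = nu :=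
    ⟨_, norm_nonneg _, rfl⟩
  obtain ⟨nv, _hnv, hnvdef⟩ : ∃ nv : ℝ, 0 ≤ nv ∧
      ‖(WithLp.toLp 2 w : EuclideanSpace ℂ (Finset (Orb (FermionTorus 2 L))))‖ = nv :=
    ⟨_, norm_nonneg _, rfl⟩
  have ha : (star φ' ⬝ᵥ φ').re = nu ^ 2 := by
    rw [← hnudef]
    exact (norm_toLp_sq_eq_re φ').symm
  have hCS : (star φ' ⬝ᵥ w).re ≤ nu * nv := by
    rw [← hnudef, ← hnvdef]
    exact re_star_dotProduct_le_norm_mul_norm φ' w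
  -- (e) the a-priori bound `‖P_{s'} ψ‖ ≤ c₀ L²`
  have hnvle : nv ≤ c₀ * (L : ℝ) ^ 2 := by
    rw [← hnvdef]
    have h := hapr L (ψ L)
    rw [h1, mul_one] at h
    exact h
  -- `S² ≤ C L² · 2 Re⟨P_s ψ, P_{s'} ψ⟩`
  have hSnn : 0 ≤ (star φ' ⬝ᵥ φ').re := by
    rw [ha]
    exact sq_nonneg nu
  have hS2 : (nu ^ 2) ^ 2 ≤ C * (L : ℝ) ^ 2 * (2 * (star φ' ⬝ᵥ w).re) := by
    rw [← hbr, ← ha]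
    exact (pow_le_pow_left₀ hSnn (Complex.re_le_norm _) 2).trans hIRφ
  -- (f) real arithmetic: `nu⁴ ≤ (2 C c₀ L⁴) nu`, hence `S³ = (nu²)³ ≤ (2 C c₀ L⁴)² = (2 C c₀)² L⁸`
  have hCL : 0 ≤ C * (L : ℝ) ^ 2 := mul_nonneg hC (sq_nonneg _)
  have hle : (star φ' ⬝ᵥ w).re ≤ nu * (c₀ * (L : ℝ) ^ 2) :=
    hCS.trans (mul_le_mul_of_nonneg_left hnvle hnu)
  have hA : nu ^ 4 ≤ (2 * C * c₀ * (L : ℝ) ^ 4) * nu := by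
    calc nu ^ 4 = (nu ^ 2) ^ 2 := by ring
      _ ≤ C * (L : ℝ) ^ 2 * (2 * (star φ' ⬝ᵥ w).re) := hS2
      _ ≤ C * (L : ℝ) ^ 2 * (2 * (nu * (c₀ * (L : ℝ) ^ 2))) :=
          mul_le_mul_of_nonneg_left (mul_le_mul_of_nonneg_left hle zero_le_two) hCL
      _ = (2 * C * c₀ * (L : ℝ) ^ 4) * nu := by ring
  rw [ha]
  calc (nu ^ 2) ^ 3 ≤ (2 * C * c₀ * (L : ℝ) ^ 4) ^ 2 := sq_pow_three_le_of_pow_four_le hnu hA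
    _ = (2 * C * c₀) ^ 2 * (L : ℝ) ^ 8 := by ring

end Summit.HubbardSuperconductivity.NoOnsiteODLRO.Birth

end
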